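import Summits.ABC.ABC.Theorems.IsogenyGlueCongruencePolyHeightOfBoundedPrimesStubPolyHallDeltaOfPolyHall
import Summits.ABC.ABC.Theorems.IsogenyGlueCongruencePolyHeightOfBoundedPrimesStubPolyStrongHallOfPolyGenSzpiro
import Summits.ABC.ABC.Theorems.DefiniteXiXiBoundExponentProductFrey
import Literature.NumberTheory.EllipticCurves.DegreeConjectureAbcPrelims

/-!
# `PolyHeightOfBoundedPrimes` (stmt-ABC-16006, crux B′) — line `Sketch` (card `archimedean-hall-split`):
the registered CALIBRATION stub `stub_hallHalfAll_iff_weakHall`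

Crux `B′ = A → H` of route IsogenyGlueCongruence (`H`: `max(|Δ_W|, |c₄(W)|³) ≤ C·N_W^σ` on semistable
global minimal elliptic `W/ℚ`). The line splits `H` into a finite half `PolySzpiroΔ` and an archimedean
"Hall half" `PolyHallΔ : |c₄(W)|³ ≤ C·|Δ_W|^{σ'}` (`0 ≤ σ'`). This file pins the Hall half WITH
SEMISTABILITY DROPPED: it is then EXACTLY the free-exponent (weak) Hall conjecture
`∃ θ > 0, c > 0, ∀ x y ∈ ℤ, x³ ≠ y² → c·|x|^θ ≤ |x³ − y²|`.

* (←) `hallHalfAll_of_weakHall`: the landed pointwise lemma `polyHallDelta_of_polyHall`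
  (`σ' = 3/θ`, `C = (1728/c)^{3/θ}`; semistability was never used there).
* (→) `weakHall_of_hallHalfAll`, through the pointwise `abs_pow_three_le_of_hallHalfAll`: WLOG `σ ≥ 1`,
  `C ≥ 0` (`hallHalfAll_mono`, using `|Δ_W| ≥ 1` on a global minimal model, `one_le_cast_abs_Δ`). Given
  integers `x, y` with `k = x³ − y² ≠ 0`, the integral equation `E : Y² = X³ − 27x·X − 54y` has
  `c₄(E) = 6⁴x`, `Δ(E) = 2⁶3⁹k ≠ 0` (`MordellTwist.hallModel_c₄/_Δ`). Take a global minimal equation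
  `W₀` over `ℤ`, `D • (E ⊗ ℚ) = W₀ ⊗ ℚ` (`exists_baseChange_int_forall_isMinimalAt`, Silverman AEC
  VIII.8.3); with `u = D.u`: `6⁴x = u⁴c₄(W₀)`, `2⁶3⁹k = u¹²Δ(W₀)`. KEY SIGN FACT `|u| ≥ 1`:
  `|Δ(W₀)| = Δ_min(W₀ ⊗ ℚ) = Δ_min(E ⊗ ℚ) ≤ |Δ(E)| = |u|¹²|Δ(W₀)|` (`minimalDiscriminantNorm_eq_natAbs`,
  isomorphism invariance of `Δ_min`, and `Δ_min ≤ |Δ|` of any integral equation, prime by prime from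
  `XiBoundExponentProduct.factorization_minimalDiscriminantNorm_le_int`). The hypothesis at `W₀ ⊗ ℚ`
  (globally minimal by `isGloballyMinimal_of_forall_isMinimalAt_int`) gives `|c₄(W₀)|³ ≤ C|Δ(W₀)|^σ`, so
  `6¹²|x|³ = |u|¹²|c₄(W₀)|³ ≤ C·|u|¹²|Δ(W₀)|·|Δ(W₀)|^{σ−1} ≤ C·(2⁶3⁹|k|)·(2⁶3⁹|k|)^{σ−1} = C(2⁶3⁹)^σ|k|^σ`
  (`|Δ(W₀)| ≤ |u|¹²|Δ(W₀)| = 2⁶3⁹|k|`, `σ − 1 ≥ 0`). With `K = C(2⁶3⁹)^σ/6¹²`: `|x|³ ≤ K|k|^σ`, i.e.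
  `K^{−1/σ}·|x|^{3/σ} ≤ |k|` (`hall_of_abs_pow_three_le`): weak Hall with `θ = 3/σ`, `c = K^{−1/σ}`.
* `stub_hallHalfAll_iff_weakHall` — the REGISTERED stub (name and signature verbatim).

Supports stmt-ABC-16006 (registered calibration stub; nothing here closes the item).

References: E. Bombieri, W. Gubler, *Heights in Diophantine Geometry* (2006), 12.5 [BombieriGubler2006];
J. H. Silverman, *The Arithmetic of Elliptic Curves*, 2nd ed. (2009), III.1, VII.1, VIII.8
[SilvermanAEC2009].
-/

noncomputable section

-- single-conjunct summit ABC: the duplicate ABC.ABC is mandated (CONVENTIONS §2)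
set_option linter.dupNamespace false

namespace Summit.ABC.ABC.Theorems.PolyHeightOfBoundedPrimes.HallSplit

open UniqueFactorizationMonoid IsDedekindDomain WeierstrassCurve Rat.HeightOneSpectrum
open Literature.NumberTheory.DiophantineGeometry Literature.NumberTheory.EllipticCurves
open Summit.ABC.ABC.Theses.IsogenyGlueCongruence

/-! ## (←) weak Hall ⟹ the Hall half on all global minimal models -/

/-- **Weak Hall ⟹ Hall half (semistability dropped).** A weak Hall bound `c·|x|^θ ≤ |x³ − y²|`
(`θ > 0`, `c > 0`) gives `|c₄(W)|³ ≤ (1728/c)^{3/θ}·|Δ_W|^{3/θ}` for every elliptic `W/ℚ` in global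
minimal form (the landed pointwise lemma `polyHallDelta_of_polyHall`: on the integral model
`1728Δ = c₄³ − c₆² ≠ 0`). [folklore] -/
theorem hallHalfAll_of_weakHall
    (h : ∃ θ c : ℝ, 0 < θ ∧ 0 < c ∧ ∀ x y : ℤ, x ^ 3 ≠ y ^ 2 →
      c * |(x : ℝ)| ^ θ ≤ |((x : ℝ) ^ 3 - (y : ℝ) ^ 2)|) :
    ∃ σ C : ℝ, 0 ≤ σ ∧ ∀ (W : WeierstrassCurve ℚ) [W.IsElliptic] [W.IsGloballyMinimal],
      ((|W.c₄| ^ 3 : ℚ) : ℝ) ≤ C * ((|W.Δ| : ℚ) : ℝ) ^ σ := by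
  obtain ⟨θ, c, hθ, hc, hHall⟩ := h
  exact ⟨3 / θ, (1728 / c) ^ (3 / θ), by positivity,
    fun W _ _ ↦ polyHallDelta_of_polyHall hθ hc hHall W⟩

/-! ## (→) the Hall half on all global minimal models ⟹ weak Hall -/

/-! ### A minimal equation minimises `|Δ|`; the scaling towards it has `|u| ≥ 1` -/

/-- **A minimal equation has the smallest discriminant in its `ℚ`-isomorphism class of integral
equations.** If `W₀ / ℤ` is minimal at every prime, `E / ℤ` has `Δ(E) ≠ 0` and `D • (E ⊗ ℚ) = W₀ ⊗ ℚ`,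
then `|Δ(W₀)| ≤ |Δ(E)|`: `|Δ(W₀)| = Δ_min(W₀ ⊗ ℚ)` (`minimalDiscriminantNorm_eq_natAbs`, Silverman AEC
VIII.8), `Δ_min` is an isomorphism invariant (`minimalDiscriminantNorm_smul_rat`), and
`Δ_min(E ⊗ ℚ) ∣ Δ(E)`, prime by prime from `ord_p(Δ_min) ≤ ord_p(Δ(E))`
(`XiBoundExponentProduct.factorization_minimalDiscriminantNorm_le_int`, AEC VII.1).
[cite: SilvermanAEC2009, VIII.8] -/
theorem natAbs_Δ_le_of_forall_isMinimalAt {E W₀ : WeierstrassCurve ℤ} {D : VariableChange ℚ}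
    (hE : E.Δ ≠ 0) (hW₀ : W₀.Δ ≠ 0) (hDW : D • E.baseChange ℚ = W₀.baseChange ℚ)
    (hmin : ∀ v : HeightOneSpectrum ℤ, (W₀.baseChange ℚ).IsMinimalAt v) :
    W₀.Δ.natAbs ≤ E.Δ.natAbs := by
  rw [← WeierstrassCurve.minimalDiscriminantNorm_eq_natAbs_holds W₀ hW₀ hmin, ← hDW,
    WeierstrassCurve.minimalDiscriminantNorm_smul_rat]
  refine Nat.le_of_dvd (Int.natAbs_pos.mpr hE) ((Nat.factorization_le_iff_dvd
    (minimalDiscriminantNorm_pos_holds _).ne' (Int.natAbs_ne_zero.mpr hE)).mp fun p ↦ ?_)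
  by_cases hp : p.Prime
  · exact XiBoundExponentProduct.factorization_minimalDiscriminantNorm_le_int E hE hp
  · simp [Nat.factorization_eq_zero_of_not_prime _ hp]

/-- **The scaling towards a smaller discriminant is at least `1`.** If `a = u¹²·b` in `ℚ` for integers
`a`, `b ≠ 0` with `|b| ≤ |a|`, then `|u| ≥ 1`. [folklore] -/
theorem one_le_abs_of_natAbs_le {a b : ℤ} {u : ℚ} (hb : b ≠ 0) (h : (a : ℚ) = u ^ 12 * b)
    (hle : b.natAbs ≤ a.natAbs) : 1 ≤ |u| := by
  have hb' : (0 : ℚ) < |(b : ℚ)| := abs_pos.mpr (by exact_mod_cast hb)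
  have hab : |b| ≤ |a| := by
    rw [Int.abs_eq_natAbs, Int.abs_eq_natAbs]
    exact_mod_cast hle
  have hab' : |(b : ℚ)| ≤ |(a : ℚ)| := by exact_mod_cast hab
  rw [h, abs_mul, abs_pow] at hab'
  have h12 : 1 ≤ |u| ^ 12 := le_of_mul_le_mul_right (by rwa [one_mul]) hb'
  by_contra hlt
  exact absurd h12 (not_le.mpr (pow_lt_one₀ (abs_nonneg u) (not_le.mp hlt) (by norm_num)))

/-! ### Real bookkeeping -/

/-- **Real bookkeeping, the scaling step.** From `c4³ ≤ C'·D^{σ'}`, `6⁴X = U⁴·c4`,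
`2⁶3⁹·k = U¹²·D` with `U ≥ 1`, `D > 0`, `k > 0`, `σ' ≥ 1`, `C' ≥ 0`:
`6¹²X³ = U¹²c4³ ≤ C'·(U¹²D)·D^{σ'−1} ≤ C'·(2⁶3⁹k)·(2⁶3⁹k)^{σ'−1} = C'(2⁶3⁹)^{σ'}k^{σ'}`
(as `D ≤ U¹²D = 2⁶3⁹k` and `t ↦ t^{σ'−1}` is monotone). [folklore] -/
theorem scaled_abs_pow_three_le {c4 D X k U C' σ' : ℝ} (hkey : c4 ^ 3 ≤ C' * D ^ σ')
    (hx : 6 ^ 4 * X = U ^ 4 * c4) (hk : 2 ^ 6 * 3 ^ 9 * k = U ^ 12 * D) (hU : 1 ≤ U)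
    (hD : 0 < D) (hk0 : 0 < k) (hσ : 1 ≤ σ') (hC : 0 ≤ C') :
    6 ^ 12 * X ^ 3 ≤ C' * (2 ^ 6 * 3 ^ 9) ^ σ' * k ^ σ' := by
  have hM0 : (0 : ℝ) < 2 ^ 6 * 3 ^ 9 * k := by positivity
  have hU12 : 1 ≤ U ^ 12 := one_le_pow₀ hU
  have hDM : D ≤ 2 ^ 6 * 3 ^ 9 * k := by rw [hk]; exact le_mul_of_one_le_left hD.le hU12
  have split : ∀ {t : ℝ}, 0 < t → t ^ σ' = t * t ^ (σ' - 1) := fun {t} ht ↦ by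
    conv_lhs => rw [show σ' = 1 + (σ' - 1) by ring, Real.rpow_add ht, Real.rpow_one]
  calc 6 ^ 12 * X ^ 3 = (6 ^ 4 * X) ^ 3 := by ring
    _ = U ^ 12 * c4 ^ 3 := by rw [hx]; ring
    _ ≤ U ^ 12 * (C' * D ^ σ') := mul_le_mul_of_nonneg_left hkey (by positivity)
    _ = C' * ((U ^ 12 * D) * D ^ (σ' - 1)) := by rw [split hD]; ring
    _ = C' * ((2 ^ 6 * 3 ^ 9 * k) * D ^ (σ' - 1)) := by rw [← hk]
    _ ≤ C' * ((2 ^ 6 * 3 ^ 9 * k) * (2 ^ 6 * 3 ^ 9 * k) ^ (σ' - 1)) :=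
        mul_le_mul_of_nonneg_left (mul_le_mul_of_nonneg_left
          (Real.rpow_le_rpow hD.le hDM (sub_nonneg.mpr hσ)) hM0.le) hC
    _ = C' * (2 ^ 6 * 3 ^ 9 * k) ^ σ' := by rw [← split hM0]
    _ = C' * (2 ^ 6 * 3 ^ 9) ^ σ' * k ^ σ' := by
        rw [Real.mul_rpow (by norm_num) hk0.le]; ring

/-- **Real bookkeeping, the inversion step.** From `X³ ≤ K·k^{σ'}` with `X ≥ 0`, `k ≥ 0`, `K > 0`,
`σ' > 0`: `K^{−1/σ'}·X^{3/σ'} ≤ k` (raise `K⁻¹X³ ≤ k^{σ'}` to the power `1/σ' ≥ 0`). [folklore] -/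
theorem hall_of_abs_pow_three_le {X k K σ' : ℝ} (hX : 0 ≤ X) (hk : 0 ≤ k) (hK : 0 < K)
    (hσ : 0 < σ') (h : X ^ 3 ≤ K * k ^ σ') :
    K⁻¹ ^ (1 / σ') * X ^ (3 / σ') ≤ k := by
  have h1 : K⁻¹ * X ^ 3 ≤ k ^ σ' := by rw [inv_mul_le_iff₀ hK]; exact h
  have h2 : (K⁻¹ * X ^ 3) ^ (1 / σ') ≤ (k ^ σ') ^ (1 / σ') :=
    Real.rpow_le_rpow (mul_nonneg (inv_nonneg.mpr hK.le) (pow_nonneg hX 3)) h1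
      (div_nonneg zero_le_one hσ.le)
  rw [Real.mul_rpow (inv_nonneg.mpr hK.le) (pow_nonneg hX 3), one_div,
    Real.rpow_rpow_inv hk hσ.ne'] at h2
  calc K⁻¹ ^ (1 / σ') * X ^ (3 / σ') = K⁻¹ ^ σ'⁻¹ * (X ^ 3) ^ σ'⁻¹ := by
        rw [one_div, div_eq_mul_inv, Real.rpow_mul hX, Real.rpow_ofNat]
    _ ≤ k := h2

/-! ### WLOG `σ ≥ 1`, `C ≥ 1` -/

/-- On a global minimal model of an elliptic curve over `ℚ` the discriminant is a nonzero integer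
(`cast_integralModelInt_Δ`), so `|Δ_W| ≥ 1`. [cite: SilvermanAEC2009, VIII.8] -/
theorem one_le_cast_abs_Δ (W : WeierstrassCurve ℚ) [W.IsElliptic] [W.IsGloballyMinimal] :
    (1 : ℝ) ≤ ((|W.Δ| : ℚ) : ℝ) := by
  have h0 : (integralModelInt W).Δ ≠ 0 := by
    intro h0
    apply W.isUnit_Δ.ne_zero
    rw [← cast_integralModelInt_Δ W, h0, Int.cast_zero]
  have h1 : (1 : ℤ) ≤ |(integralModelInt W).Δ| := Int.one_le_abs h0
  rw [← cast_integralModelInt_Δ W]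
  exact_mod_cast h1

/-- **WLOG `σ ≥ 1`, `C ≥ 1` in the Hall half.** Since `|Δ_W| ≥ 1` on global minimal models
(`one_le_cast_abs_Δ`), `C·|Δ_W|^σ ≤ max(C,1)·|Δ_W|^{max(σ,1)}`. [folklore] -/
theorem hallHalfAll_mono {σ C : ℝ}
    (h : ∀ (W : WeierstrassCurve ℚ) [W.IsElliptic] [W.IsGloballyMinimal],
      ((|W.c₄| ^ 3 : ℚ) : ℝ) ≤ C * ((|W.Δ| : ℚ) : ℝ) ^ σ)
    (W : WeierstrassCurve ℚ) [W.IsElliptic] [W.IsGloballyMinimal] :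
    ((|W.c₄| ^ 3 : ℚ) : ℝ) ≤ max C 1 * ((|W.Δ| : ℚ) : ℝ) ^ max σ 1 := by
  have h1 := one_le_cast_abs_Δ W
  calc ((|W.c₄| ^ 3 : ℚ) : ℝ) ≤ C * ((|W.Δ| : ℚ) : ℝ) ^ σ := h W
    _ ≤ max C 1 * ((|W.Δ| : ℚ) : ℝ) ^ σ :=
        mul_le_mul_of_nonneg_right (le_max_left _ _) (Real.rpow_nonneg (zero_le_one.trans h1) _)
    _ ≤ max C 1 * ((|W.Δ| : ℚ) : ℝ) ^ max σ 1 :=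
        mul_le_mul_of_nonneg_left (Real.rpow_le_rpow_of_exponent_le h1 (le_max_left _ _))
          (zero_le_one.trans (le_max_right _ _))

/-! ### The pointwise transfer through `Y² = X³ − 27x·X − 54y` -/

/-- **Hall half (all global minimal models, `σ ≥ 1`, `C ≥ 0`) ⟹ `|x|³ ≤ C(2⁶3⁹)^σ/6¹² · |x³ − y²|^σ`.**
For integers `x, y` with `k = x³ − y² ≠ 0` take `E : Y² = X³ − 27x·X − 54y` over `ℤ`
(`c₄(E) = 6⁴x`, `Δ(E) = 2⁶3⁹k`; Silverman AEC III.1) and a global minimal equation `W₀ / ℤ` with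
`D • (E ⊗ ℚ) = W₀ ⊗ ℚ` (AEC VIII.8.3); with `u = D.u`, `6⁴x = u⁴c₄(W₀)`, `2⁶3⁹k = u¹²Δ(W₀)` and
`|u| ≥ 1` because `|Δ(W₀)| = Δ_min ≤ |Δ(E)| = |u|¹²|Δ(W₀)|`. The hypothesis at `W₀ ⊗ ℚ` gives
`|c₄(W₀)|³ ≤ C|Δ(W₀)|^σ`, whence `6¹²|x|³ = |u|¹²|c₄(W₀)|³ ≤ C(2⁶3⁹)^σ|k|^σ`
(`scaled_abs_pow_three_le`). [cite: SilvermanAEC2009, VIII.8] -/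
theorem abs_pow_three_le_of_hallHalfAll {σ C : ℝ} (hσ : 1 ≤ σ) (hC0 : 0 ≤ C)
    (hC : ∀ (W : WeierstrassCurve ℚ) [W.IsElliptic] [W.IsGloballyMinimal],
      ((|W.c₄| ^ 3 : ℚ) : ℝ) ≤ C * ((|W.Δ| : ℚ) : ℝ) ^ σ)
    (x y : ℤ) (hxy : x ^ 3 ≠ y ^ 2) :
    6 ^ 12 * |(x : ℝ)| ^ 3 ≤ C * (2 ^ 6 * 3 ^ 9) ^ σ * |((x : ℝ) ^ 3 - (y : ℝ) ^ 2)| ^ σ := by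
  have hz : x ^ 3 - y ^ 2 ≠ 0 := sub_ne_zero.mpr hxy
  -- the integral model `Y² = X³ − 27x X − 54y` with `(c₄, Δ) = (6⁴x, 2⁶3⁹(x³ − y²))`
  set E : WeierstrassCurve ℤ := ⟨0, 0, 0, -27 * x, -54 * y⟩ with hE
  have hEc₄ : E.c₄ = 6 ^ 4 * x := MordellTwist.hallModel_c₄ x y
  have hEΔ : E.Δ = 2 ^ 6 * 3 ^ 9 * (x ^ 3 - y ^ 2) := MordellTwist.hallModel_Δ x y
  have hΔ0 : E.Δ ≠ 0 := by rw [hEΔ]; exact mul_ne_zero (by norm_num) hz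
  haveI hell : (E.baseChange ℚ).IsElliptic := isElliptic_baseChange_int E hΔ0
  -- a global minimal equation `W₀` over `ℤ`, `D • (E ⊗ ℚ) = W₀ ⊗ ℚ`
  obtain ⟨D, W₀, hDW, hmin⟩ := exists_baseChange_int_forall_isMinimalAt (E.baseChange ℚ)
  have hΔ0' : W₀.Δ ≠ 0 := by
    intro h0
    have h1 : (D • E.baseChange ℚ).Δ = 0 := by rw [hDW, baseChange_int_Δ, h0, Int.cast_zero]
    exact (D • E.baseChange ℚ).isUnit_Δ.ne_zero h1
  haveI hell' : (W₀.baseChange ℚ).IsElliptic := isElliptic_baseChange_int W₀ hΔ0'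
  haveI hglob : (W₀.baseChange ℚ).IsGloballyMinimal :=
    isGloballyMinimal_of_forall_isMinimalAt_int _ hmin
  -- the hypothesis at `W₀ ⊗ ℚ`
  have key : |(W₀.c₄ : ℝ)| ^ 3 ≤ C * |(W₀.Δ : ℝ)| ^ σ := by
    have h := hC (W₀.baseChange ℚ)
    rw [baseChange_int_c₄, baseChange_int_Δ] at h
    push_cast at h
    exact h
  -- the scaling `u = D.u`: `6⁴ x = u⁴ c₄(W₀)`, `Δ(E) = u¹² Δ(W₀)`
  set u : ℚ := (D.u : ℚ) with hu
  have hu0 : u ≠ 0 := D.u.ne_zero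
  have r4 : ((6 ^ 4 * x : ℤ) : ℚ) = u ^ 4 * W₀.c₄ := by
    have h := congrArg WeierstrassCurve.c₄ hDW
    rw [variableChange_c₄, baseChange_int_c₄, baseChange_int_c₄, hEc₄, Units.val_inv_eq_inv_val,
      ← hu] at h
    rw [← h]; field_simp
  have r12 : (E.Δ : ℚ) = u ^ 12 * W₀.Δ := by
    have h := congrArg WeierstrassCurve.Δ hDW
    rw [variableChange_Δ, baseChange_int_Δ, baseChange_int_Δ, Units.val_inv_eq_inv_val, ← hu] at h
    rw [← h]; field_simp
  -- `|u| ≥ 1`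
  have hu1 : 1 ≤ |u| :=
    one_le_abs_of_natAbs_le hΔ0' r12 (natAbs_Δ_le_of_forall_isMinimalAt hΔ0 hΔ0' hDW hmin)
  -- over `ℝ`
  have hxR : (6 : ℝ) ^ 4 * |(x : ℝ)| = |(u : ℝ)| ^ 4 * |(W₀.c₄ : ℝ)| := by
    have h : (((6 ^ 4 * x : ℤ) : ℚ) : ℝ) = ((u ^ 4 * W₀.c₄ : ℚ) : ℝ) := by rw [r4]
    push_cast at h
    have h' : (6 : ℝ) ^ 4 * (x : ℝ) = (u : ℝ) ^ 4 * (W₀.c₄ : ℝ) := by linear_combination h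
    calc (6 : ℝ) ^ 4 * |(x : ℝ)| = |(6 : ℝ) ^ 4 * x| := by
          rw [abs_mul, abs_pow, abs_of_pos (by norm_num : (0 : ℝ) < 6)]
      _ = |(u : ℝ) ^ 4 * (W₀.c₄ : ℝ)| := by rw [h']
      _ = |(u : ℝ)| ^ 4 * |(W₀.c₄ : ℝ)| := by rw [abs_mul, abs_pow]
  have hkR : (2 : ℝ) ^ 6 * 3 ^ 9 * |((x : ℝ) ^ 3 - (y : ℝ) ^ 2)| =
      |(u : ℝ)| ^ 12 * |(W₀.Δ : ℝ)| := by
    have h : (((E.Δ : ℤ) : ℚ) : ℝ) = ((u ^ 12 * W₀.Δ : ℚ) : ℝ) := by rw [r12]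
    rw [hEΔ] at h
    push_cast at h
    have h' : (2 : ℝ) ^ 6 * 3 ^ 9 * ((x : ℝ) ^ 3 - (y : ℝ) ^ 2) = (u : ℝ) ^ 12 * (W₀.Δ : ℝ) := by
      linear_combination h
    calc (2 : ℝ) ^ 6 * 3 ^ 9 * |((x : ℝ) ^ 3 - (y : ℝ) ^ 2)|
          = |(2 : ℝ) ^ 6 * 3 ^ 9 * ((x : ℝ) ^ 3 - (y : ℝ) ^ 2)| := by
          rw [abs_mul (2 ^ 6 * 3 ^ 9 : ℝ), abs_of_pos (by norm_num : (0 : ℝ) < 2 ^ 6 * 3 ^ 9)]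
      _ = |(u : ℝ) ^ 12 * (W₀.Δ : ℝ)| := by rw [h']
      _ = |(u : ℝ)| ^ 12 * |(W₀.Δ : ℝ)| := by rw [abs_mul, abs_pow]
  have hU1 : (1 : ℝ) ≤ |(u : ℝ)| := by
    rw [← Rat.cast_abs]
    exact_mod_cast hu1
  have hD0 : (0 : ℝ) < |(W₀.Δ : ℝ)| := abs_pos.mpr (by exact_mod_cast hΔ0')
  have hk0 : (0 : ℝ) < |((x : ℝ) ^ 3 - (y : ℝ) ^ 2)| := abs_pos.mpr (by exact_mod_cast hz)
  exact scaled_abs_pow_three_le key hxR hkR hU1 hD0 hk0 hσ hC0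

/-- **Hall half on all global minimal models ⟹ weak Hall.** If `|c₄(W)|³ ≤ C·|Δ_W|^σ` for every
elliptic `W/ℚ` in global minimal form, then `c·|x|^θ ≤ |x³ − y²|` for all integers with `x³ ≠ y²`,
with `θ = 3/max(σ,1)` and `c = K^{−1/max(σ,1)}`, `K = max(C,1)·(2⁶3⁹)^{max(σ,1)}/6¹²`
(`hallHalfAll_mono`, `abs_pow_three_le_of_hallHalfAll`, `hall_of_abs_pow_three_le`).
[cite: BombieriGubler2006, 12.5] -/
theorem weakHall_of_hallHalfAll
    (h : ∃ σ C : ℝ, 0 ≤ σ ∧ ∀ (W : WeierstrassCurve ℚ) [W.IsElliptic] [W.IsGloballyMinimal],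
      ((|W.c₄| ^ 3 : ℚ) : ℝ) ≤ C * ((|W.Δ| : ℚ) : ℝ) ^ σ) :
    ∃ θ c : ℝ, 0 < θ ∧ 0 < c ∧ ∀ x y : ℤ, x ^ 3 ≠ y ^ 2 →
      c * |(x : ℝ)| ^ θ ≤ |((x : ℝ) ^ 3 - (y : ℝ) ^ 2)| := by
  obtain ⟨σ, C, _hσ, hC⟩ := h
  have hσ1 : (1 : ℝ) ≤ max σ 1 := le_max_right _ _
  have hσ0 : (0 : ℝ) < max σ 1 := one_pos.trans_le hσ1
  have hC0 : (0 : ℝ) ≤ max C 1 := zero_le_one.trans (le_max_right _ _)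
  have hK0 : (0 : ℝ) < max C 1 * (2 ^ 6 * 3 ^ 9) ^ max σ 1 / 6 ^ 12 := by
    have : (0 : ℝ) < max C 1 := one_pos.trans_le (le_max_right _ _)
    positivity
  refine ⟨3 / max σ 1, (max C 1 * (2 ^ 6 * 3 ^ 9) ^ max σ 1 / 6 ^ 12)⁻¹ ^ (1 / max σ 1),
    div_pos (by norm_num) hσ0, Real.rpow_pos_of_pos (inv_pos.mpr hK0) _, fun x y hxy ↦ ?_⟩
  have step := abs_pow_three_le_of_hallHalfAll hσ1 hC0 (fun W _ _ ↦ hallHalfAll_mono hC W) x y hxy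
  refine hall_of_abs_pow_three_le (abs_nonneg _) (abs_nonneg _) hK0 hσ0 ?_
  rw [div_mul_eq_mul_div, le_div_iff₀ (by positivity)]
  linarith [step]

/-! ## The registered stub -/

/-- **CALIBRATION STUB (registered on stmt-ABC-16006; line `Sketch`, card archimedean-hall-split).**
With semistability dropped, the Hall half `∃ σ ≥ 0, C, ∀ W/ℚ elliptic globally minimal,
|c₄(W)|³ ≤ C·|Δ_W|^σ` is EXACTLY the free-exponent (weak) Hall conjecture
`∃ θ > 0, c > 0, ∀ x y ∈ ℤ, x³ ≠ y² → c·|x|^θ ≤ |x³ − y²|`: (←) on the integral global minimal model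
`1728Δ = c₄³ − c₆²` (`polyHallDelta_of_polyHall`); (→) through the curve `Y² = X³ − 27x·X − 54y`
(`c₄ = 6⁴x`, `Δ = 2⁶3⁹(x³ − y²)`) and a global minimal equation of it, whose scaling `u` has `|u| ≥ 1`
because a minimal equation minimises `|Δ|` (Silverman AEC VIII.8). So the Hall half is a purely
Diophantine statement about Mordell curves, of the strength of Hall's conjecture with a free exponent
(Bombieri–Gubler 12.5). [cite: BombieriGubler2006, 12.5] -/
theorem stub_hallHalfAll_iff_weakHall :
    (∃ σ C : ℝ, 0 ≤ σ ∧ ∀ (W : WeierstrassCurve ℚ) [W.IsElliptic] [W.IsGloballyMinimal],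
        ((|W.c₄| ^ 3 : ℚ) : ℝ) ≤ C * ((|W.Δ| : ℚ) : ℝ) ^ σ) ↔
    (∃ θ c : ℝ, 0 < θ ∧ 0 < c ∧ ∀ x y : ℤ, x ^ 3 ≠ y ^ 2 →
      c * |(x : ℝ)| ^ θ ≤ |((x : ℝ) ^ 3 - (y : ℝ) ^ 2)|) :=
  ⟨weakHall_of_hallHalfAll, hallHalfAll_of_weakHall⟩

end Summit.ABC.ABC.Theorems.PolyHeightOfBoundedPrimes.HallSplit

end
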